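import Mathlib.LinearAlgebra.Matrix.Notation
import Mathlib.Data.Fin.VecNotation
import Mathlib.LinearAlgebra.Matrix.Determinant.Basic
import Mathlib.Tactic.Ring
import Mathlib.Tactic.NormNum
import HarnessLib

/-!
# Hu (arXiv:2507.21400, claimed): a matroid Schubert cell whose Γ-scheme is not integral — exact certificate

`Literature/AlgebraicGeometry/Hu2025/GammaSchemeNotIntegral.lean`. Reproduction / referee material
for a CLAIMED result under adjudication (repair cell `pub-hironaka`, unit `b2b-hironaka-cp4`,
file `OBSTRUCTIONS-DIM4.md` §10, row O-Hu, step G-Hu1). Nothing in this file asserts or denies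
Hu's theorems; every declaration below is a definition with body or a theorem proved by `decide` /
`ring` over `ℤ`.

**Sources (as read).** Yi Hu, *Universal characteristic-free resolution of singularities, I*,
arXiv:2507.21400v1 (2025), 162 pp. (bib `Hu2025`): Thm 1.1 ("resolution of singularity types"),
Thm 1.3 = Thm 8.5 + Thm 8.6 (for `Γ ⊂ Var_U` with the Γ-scheme `Z_Γ` INTEGRAL, the `ℓ`-transform
`Z̃_{ℓ,Γ}` is smooth and `Z̃†_{ℓ,Γ} → Z_Γ` is surjective projective birational), Def 7.1
(`Z_Γ := U ∩ Gr^{3,E} ∩ {x_u = 0, u ∈ Γ}`, `U = (p₁₂₃ ≠ 0)`), App. §9 (9.?) `Γ := Γ_d = {i : x_i ∉ Δ_d}`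
= the non-bases of the matroid `d`, Prop 9.1 (= Lafforgue, *Chirurgie des grassmanniennes* (2003),
Prop. p. 4, bib `Lafforgue2003`, not held here): the matroid Schubert cell `Gr_d` is
`{p_i = 0, i ∉ bases(d)} ∩ {p_i ≠ 0, i ∈ bases(d)}`, i.e. an OPEN subscheme of `Z_{Γ_d}`; and
Yi Hu, *Resolution of singularities in arbitrary characteristic*, arXiv:2203.03842v4 (2022) (bib
`Hu2022`), proof of Thm 9.5, p. 131: "and `Gr_d` is an open subset of the Γ-scheme `Z_Γ ⊂ U_m`. As `X`
is integral (by assumption), one sees that `Z_Γ` is integral." — the only printed justification of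
the hypothesis of Thm 1.3/8.5 at the interface with Lafforgue–Mnëv universality (2507.21400 §2.1:
"We aim to resolve `Z_Γ`, hence also the matroid Schubert cell `Z_Γ° := Gr_d`, when both are integral
and singular").

**What is certified here (exact integer arithmetic, kernel-checked).** On the chart `U = (p₁₂₃ ≠ 0)`
of `Gr(3,9)` a point is a `3 × 9` matrix `[I₃ | A]`, i.e. nine column vectors `a₁ = e₁, a₂ = e₂,
a₃ = e₃, a₄, …, a₉ ∈ ℤ³`, and the Plücker coordinate `p_{ijk}` is `det(a_i, a_j, a_k)` (`det3`
below; `det3_eq_det`). `U ∩ Gr(3,9) ≅ 𝔸¹⁸` with coordinates the entries of `a₄,…,a₉`, and for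
`Γ ⊂ {ijk ≠ 123}` the Γ-scheme is `Z_Γ ≅ Spec ℤ[a₄,…,a₉]/(det(a_i,a_j,a_k) : ijk ∈ Γ)`.
Let `d` be the rank-3 matroid of the configuration `Q` below (the frame `e₁,e₂,e₃` and the six
vertices of a complete quadrilateral: lines `{4,5,6}, {4,7,8}, {5,7,9}, {6,8,9}`).
* `vanishing_Q`: the triples `ijk` with `p_{ijk}(Q) = 0` are EXACTLY `Γ := {456, 478, 579, 689}`
  (0-based `(3,4,5),(3,6,7),(4,6,8),(5,7,8)`); so `Γ = Γ_d`, `Q ∈ Gr_d` (Prop 9.1), `Gr_d ≠ ∅`.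
* `inner_triples_vanish_P`: at the configuration `P` (all of `a₄,…,a₉` in the plane `z = x + y`)
  all twenty `p_{uvw}`, `4 ≤ u < v < w ≤ 9`, vanish; so `P ∈ W := {rank(a₄,…,a₉) ≤ 2} ⊆ Z_Γ`
  (`W` = the determinantal variety of `3 × 6` matrices of rank `≤ 2`: irreducible of dimension
  `2·(3+6−2) = 14` over any field).
* `det3_add_smul_first/second/third`: `det3` is multilinear, so the gradient of
  `A ↦ det(a_u,a_v,a_w)` with respect to `a_u, a_v, a_w` is `(a_v × a_w, a_w × a_u, a_u × a_v)`
  (`cross`); `jac A` is the resulting `4 × 18` Jacobian matrix of the four Γ-equations.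
* `jacP_mul_N`: `jac P · N = 1₄` for an explicit integer `18 × 4` matrix `N`; hence `jac P` has rank
  4 over EVERY field. By the Jacobian criterion `Z_Γ` is smooth of dimension `18 − 4 = 14` at `P`
  (over `ℚ` and over every `𝔽_p`), so exactly one irreducible component of `Z_Γ` passes through
  `P`, it has dimension 14, and — containing the irreducible 14-dimensional `W ∋ P` — it IS `W`.
* `R_in_ZGamma`, `R_unit_minor`: the configuration `R` lies in `Z_Γ` and has `p_{469}(R) = 1`, so
  `R ∉ W` over every field; likewise `Q ∉ W` over `ℚ` (`Q_457 : p_{457}(Q) = −64`). Hence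
  `Z_Γ ≠ W`, and `Z_Γ` has at least two irreducible components: **`Z_{Γ_d}` is not integral**
  (over `ℚ` and over every `𝔽_p`), although `Gr_d` — an open subset of (four lines in general
  position w.r.t. the frame) × (six scalings) — is smooth and irreducible, and `jac Q` has rank 4
  too (`jacQ_mul_NQ`). `d` is connected (every two elements lie in a 3- or 4-element circuit), so
  `𝔾_m⁹/𝔾_m` acts freely on `Gr_d` (Hu Thm 9.3) and `X := Gr_d/(𝔾_m⁹/𝔾_m)` is a smooth integral
  affine scheme satisfying the conclusion of Hu's Thm 9.4 with `r = 0`, `U = X`.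
Consequence recorded in the census (not a Lean statement): the inference "X integral ⇒ Z_Γ
integral" (2203.03842v4 p.131) is false as an inference, and Thm 1.3 of 2507.21400 (hypothesis:
`Z_Γ` integral) is silent for this `Γ_d`; whether the matroids produced by Lafforgue's Thm I.14
for a given singular `X` have integral Γ-schemes is not proved in any of arXiv:2109.02968,
2203.03842, 2507.21400, 2608.10272. Scaling remark: for `k` lines in general position and their
`m = k(k−1)/2` intersection points, `dim closure(Gr_d) = 3m − k(k−3)` while `dim W = 2m + 2`
(`k = 4`: 14 = 14; `k = 5`: 20 < 22).

Companion files (exact arithmetic, plain Python): `papers/ResolutionOfSingularities/hironaka-charp/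
b2b-hironaka-cp4/hu_gamma_witness.{py,out}`.
-/

namespace Literature.AlgebraicGeometry.Hu2025

/-- Integer column vectors of length 3. [folklore] -/
abbrev Vec3 : Type := Fin 3 → ℤ

/-- Dot product on `ℤ³`. [folklore] -/
def dot (u v : Vec3) : ℤ := u 0 * v 0 + u 1 * v 1 + u 2 * v 2

/-- Cross product on `ℤ³` (the gradient of `det3 u v ·`). [folklore] -/
def cross (u v : Vec3) : Vec3 :=
  ![u 1 * v 2 - u 2 * v 1, u 2 * v 0 - u 0 * v 2, u 0 * v 1 - u 1 * v 0]

/-- `3 × 3` determinant of three column vectors (cofactor expansion along the first column). [folklore] -/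
def det3 (u v w : Vec3) : ℤ :=
  u 0 * (v 1 * w 2 - v 2 * w 1) - u 1 * (v 0 * w 2 - v 2 * w 0) + u 2 * (v 0 * w 1 - v 1 * w 0)

/-- Component `0` of the cross product. [folklore] -/
@[simp] lemma cross_zero (u v : Vec3) : cross u v 0 = u 1 * v 2 - u 2 * v 1 := rfl
/-- Component `1` of the cross product. [folklore] -/
@[simp] lemma cross_one (u v : Vec3) : cross u v 1 = u 2 * v 0 - u 0 * v 2 := rfl
/-- Component `2` of the cross product. [folklore] -/
@[simp] lemma cross_two (u v : Vec3) : cross u v 2 = u 0 * v 1 - u 1 * v 0 := rfl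

/-- `det3` is the determinant of the matrix with rows (equivalently columns) `u, v, w`. [folklore] -/
theorem det3_eq_det (u v w : Vec3) : det3 u v w = Matrix.det (Matrix.of ![u, v, w]) := by
  rw [Matrix.det_fin_three]
  simp [det3]
  ring

/-- `det3 u v w = ⟨u × v, w⟩`. [folklore] -/
theorem det3_eq_dot_cross (u v w : Vec3) : det3 u v w = dot (cross u v) w := by
  simp [det3, dot]; ring

/-- Multilinearity in the first slot: the gradient of `det3 · v w` is `v × w`. [folklore] -/
theorem det3_add_smul_first (u v w x : Vec3) (t : ℤ) :
    det3 (u + t • x) v w = det3 u v w + t * dot (cross v w) x := by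
  simp [det3, dot, Pi.add_apply]; ring

/-- Multilinearity in the second slot: the gradient of `det3 u · w` is `w × u`. [folklore] -/
theorem det3_add_smul_second (u v w x : Vec3) (t : ℤ) :
    det3 u (v + t • x) w = det3 u v w + t * dot (cross w u) x := by
  simp [det3, dot, Pi.add_apply]; ring

/-- Multilinearity in the third slot: the gradient of `det3 u v ·` is `u × v`. [folklore] -/
theorem det3_add_smul_third (u v w x : Vec3) (t : ℤ) :
    det3 u v (w + t • x) = det3 u v w + t * dot (cross u v) x := by
  simp [det3, dot, Pi.add_apply]; ring

/-! ## The three configurations -/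

/-- `Q`: the frame `e₁,e₂,e₃` and the six vertices of the complete quadrilateral cut out by the four
lines with normal vectors `(-2,-2,2), (-1,2,-3), (-2,3,-2), (2,-2,1)` (pairwise intersections, made
primitive): `a₄ = L₁L₂, a₅ = L₁L₃, a₆ = L₁L₄, a₇ = L₂L₃, a₈ = L₂L₄, a₉ = L₃L₄`. [folklore] -/
def Q : Fin 9 → Vec3 :=
  ![![1, 0, 0], ![0, 1, 0], ![0, 0, 1],
    ![1, -4, -3], ![1, 4, 5], ![1, 3, 4], ![5, 4, 1], ![4, 5, 2], ![1, 2, 2]]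

/-- `P`: the frame and six pairwise independent vectors in the plane `z = x + y` (rank 2). [folklore] -/
def P : Fin 9 → Vec3 :=
  ![![1, 0, 0], ![0, 1, 0], ![0, 0, 1],
    ![2, 1, 3], ![1, 2, 3], ![1, 1, 2], ![1, -2, -1], ![2, -1, 1], ![0, 1, 1]]

/-- `R`: a `0/1` point of `Z_Γ` with `rank(a₄,…,a₉) = 3` over every field. [folklore] -/
def R : Fin 9 → Vec3 :=
  ![![1, 0, 0], ![0, 1, 0], ![0, 0, 1],
    ![0, 1, 0], ![0, 1, 0], ![0, 0, 1], ![0, 1, 0], ![0, 0, 1], ![1, 0, 0]]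

/-- All `84` triples `i < j < k` in `Fin 9` (0-based), in lexicographic order. [folklore] -/
def triples : List (Fin 9 × Fin 9 × Fin 9) :=
  (List.finRange 9).flatMap fun i => (List.finRange 9).flatMap fun j =>
    (List.finRange 9).filterMap fun k => if i < j ∧ j < k then some (i, j, k) else none

/-- The Plücker coordinate `p_t(A) = det(a_i, a_j, a_k)` for `t = (i,j,k)`. [folklore] -/
def pl (A : Fin 9 → Vec3) (t : Fin 9 × Fin 9 × Fin 9) : ℤ := det3 (A t.1) (A t.2.1) (A t.2.2)

/-- The triples `t` with `p_t(A) = 0`. [folklore] -/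
def vanishing (A : Fin 9 → Vec3) : List (Fin 9 × Fin 9 × Fin 9) :=
  triples.filter fun t => decide (pl A t = 0)

/-- `Γ = {456, 478, 579, 689}` (1-based labels), i.e. 0-based `(3,4,5), (3,6,7), (4,6,8), (5,7,8)`:
the collinear triples of the complete quadrilateral. [folklore] -/
def Gamma : List (Fin 9 × Fin 9 × Fin 9) := [(3, 4, 5), (3, 6, 7), (4, 6, 8), (5, 7, 8)]

/-- There are `84 = C(9,3)` triples. [folklore] -/
theorem triples_length : triples.length = 84 := by decide +kernel

/-- The frame triple is not among `triples`' Γ and `p₁₂₃ = 1` at all three configurations. [folklore] -/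
theorem frame_det : pl Q (0, 1, 2) = 1 ∧ pl P (0, 1, 2) = 1 ∧ pl R (0, 1, 2) = 1 := by decide +kernel

/-- **Exactly** the four quadrilateral triples have vanishing Plücker coordinate at `Q`: the matroid
of `Q` has non-bases `Γ`, and `Q` lies in the matroid Schubert cell `Gr_d = Z_Γ ∩ {p_i ≠ 0, i ∉ Γ}`. [folklore] -/
theorem vanishing_Q : vanishing Q = Gamma := by decide +kernel

/-- `p₄₅₇(Q) = -64 ≠ 0`: `Q ∉ W = {rank(a₄,…,a₉) ≤ 2}` (in every characteristic `≠ 2`). [folklore] -/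
theorem Q_457 : pl Q (3, 4, 6) = -64 := by decide

/-- At `P` every triple among `a₄,…,a₉` is dependent: `P ∈ W ⊆ Z_Γ`. [folklore] -/
theorem inner_triples_vanish_P : ∀ t ∈ triples, 3 ≤ t.1.val → pl P t = 0 := by decide +kernel

/-- In particular the four Γ-equations vanish at `P`. [folklore] -/
theorem Gamma_vanish_P : ∀ t ∈ Gamma, pl P t = 0 := by decide +kernel

/-- `rank(a₄,…,a₉)(P) = 2` exactly, over every field: all `3 × 3` minors vanish
(`inner_triples_vanish_P`) and the `2 × 2` minor of `(a₆, a₉)` on coordinates `0, 1` equals `1`. [folklore] -/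
theorem P_rank_two_witness : P 5 0 * P 8 1 - P 5 1 * P 8 0 = 1 := by decide

/-- `R ∈ Z_Γ`: the four Γ-equations vanish at `R`. [folklore] -/
theorem R_in_ZGamma : ∀ t ∈ Gamma, pl R t = 0 := by decide +kernel

/-- `p₄₆₉(R) = 1`: `rank(a₄,…,a₉)(R) = 3` over every field, so `R ∈ Z_Γ ∖ W` in every
characteristic. [folklore] -/
theorem R_unit_minor : pl R (3, 5, 8) = 1 := by decide

/-! ## The Jacobian of the four Γ-equations -/

/-- The four Γ-triples as a function on `Fin 4`. [folklore] -/
def GammaVec : Fin 4 → Fin 9 × Fin 9 × Fin 9 := ![(3, 4, 5), (3, 6, 7), (4, 6, 8), (5, 7, 8)]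

/-- `GammaVec` lists `Gamma`. [folklore] -/
theorem GammaVec_list : List.ofFn GammaVec = Gamma := by decide +kernel

/-- Gradient of `A ↦ p_t(A)` with respect to the column `a_u` (`det3_add_smul_first/second/third`):
`a_v × a_w`, `a_w × a_u`, `a_u × a_v` for `u = t.1, t.2.1, t.2.2`, and `0` otherwise. [folklore] -/
def grad (A : Fin 9 → Vec3) (t : Fin 9 × Fin 9 × Fin 9) (u : Fin 9) : Vec3 :=
  if u = t.1 then cross (A t.2.1) (A t.2.2)
  else if u = t.2.1 then cross (A t.2.2) (A t.1)
  else if u = t.2.2 then cross (A t.1) (A t.2.1)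
  else 0

/-- The `4 × 18` Jacobian matrix of `(p_t)_{t ∈ Γ}` with respect to the 18 coordinates of
`a₄,…,a₉` (column `c` ↔ coordinate `c % 3` of `a_{4 + c/3}`), evaluated at `A`. [folklore] -/
def jac (A : Fin 9 → Vec3) (r : Fin 4) (c : Fin 18) : ℤ :=
  grad A (GammaVec r) ⟨3 + c.val / 3, by omega⟩ ⟨c.val % 3, by omega⟩

/-- An explicit integer right inverse of `jac P` (supported on the columns `a₄[0], a₅[0], a₆[0],
a₈[0]`, whose `4 × 4` minor of `jac P` is unimodular). [folklore] -/
def N (c : Fin 18) (j : Fin 4) : ℤ :=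
  if c.val = 0 then ![10, 3, 10, -15] j
  else if c.val = 3 then ![0, 0, -1, 0] j
  else if c.val = 6 then ![3, 1, 3, -5] j
  else if c.val = 12 then ![6, 2, 6, -9] j
  else 0

/-- Entry `(i,j)` of the product `jac A · M` over the 18 coordinates. [folklore] -/
def mulEntry (A : Fin 9 → Vec3) (M : Fin 18 → Fin 4 → ℤ) (i j : Fin 4) : ℤ :=
  ((List.finRange 18).map fun c => jac A i c * M c j).sum

/-- **`jac P · N = 1₄`**: the Jacobian of the four Γ-equations at `P` has an integer right inverse,
hence rank `4` over every field (`Z_Γ` is smooth of dimension `14` at `P` by the Jacobian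
criterion). [folklore] -/
theorem jacP_mul_N : ∀ i j : Fin 4, mulEntry P N i j = if i = j then 1 else 0 := by decide +kernel

/-- `mulEntry` is matrix multiplication: `jac A · M` as a product of `Matrix.of`'s. [folklore] -/
theorem of_jac_mul (A : Fin 9 → Vec3) (M : Fin 18 → Fin 4 → ℤ) :
    Matrix.of (jac A) * Matrix.of M = Matrix.of (mulEntry A M) := by
  ext i j
  simp [Matrix.mul_apply, mulEntry, Fin.sum_univ_def]

/-- Matrix form of `jacP_mul_N`: `Matrix.of (jac P) * Matrix.of N = 1`. [folklore] -/
theorem of_jacP_mul_of_N : Matrix.of (jac P) * Matrix.of N = 1 := by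
  rw [of_jac_mul]
  ext i j
  rw [Matrix.of_apply, jacP_mul_N, Matrix.one_apply]

/-- The Jacobian rows at `P`, for the record (row `456`). [folklore] -/
theorem jacP_row0 : List.ofFn (jac P 0) =
    [1, 1, -1, 1, 1, -1, -3, -3, 3, 0, 0, 0, 0, 0, 0, 0, 0, 0] := by decide +kernel

/-- An explicit integer right inverse of `jac Q`: the `4 × 18` Jacobian at `Q` is unimodular too,
so `Gr_d` (open in `Z_Γ`) is smooth of dimension `14` at `Q` over every field. [folklore] -/
def NQ (c : Fin 18) (j : Fin 4) : ℤ :=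
  if c.val = 0 then ![145, -48, 0, 24] j
  else if c.val = 8 then ![-18, 6, 0, -3] j
  else if c.val = 9 then ![-279, 93, 2, -48] j
  else if c.val = 10 then ![-186, 62, 1, -32] j
  else if c.val = 12 then ![27, -9, 0, 5] j
  else 0

/-- **`jac Q · NQ = 1₄`**. [folklore] -/
theorem jacQ_mul_NQ : ∀ i j : Fin 4, mulEntry Q NQ i j = if i = j then 1 else 0 := by decide +kernel

end Literature.AlgebraicGeometry.Hu2025
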